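import Mathlib
import Literature.NumberTheory.LFunctions.WeilGroundState
import Literature.NumberTheory.LFunctions.WeilGroundStateRealZerosProofs
import HarnessLib

/-!
# Crux `GroundStateSimpleEven` (stmt-RiemannHypothesis-1526), line `parity-multiplicity-commutator`,
# stub INTERTWINE — helper 3: the odd part of the edge-cancelled derivative is non-zero

Support file (`--supports stmt-RiemannHypothesis-1526`) for the stub
`stub_oddMinimisers_of_edgeCancelledPair`.  Normalisation of
`Literature/NumberTheory/LFunctions/WeilExplicit.lean` and `WeilGroundState.lean`
(`IsWeilGroundState a u`: `u ∈ L²` is the `L²`-limit of a normalised minimising sequence of window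
test functions).

## Contents (everything proved; Mathlib + proved tree files only)

* `integral_norm_sq_oddPart_sub_le`, `tendsto_integral_norm_sq_oddPart`: odd parts
  `½(g − g(-·))` are `L²`-contractions, so they converge along `L²`-convergent sequences.
* `integral_norm_sq_oddPart_pos` (registered as `stub_intertwine_oddPartNonzero`): in the
  situation of the EDGE data — `u₁, u₂` EVEN ground states with `∫ conj u₁ · u₂ = 0`,
  `(c₁, c₂) ≠ 0`, `H ∈ L²` vanishing a.e. off `[-a, a]` with `∫ H = 0` and
  `c₂u₁ − c₁u₂ = ∫_{-a}^t H` a.e. — the odd part `H_o = ½(H − H(-·))` of `H` is not `0` in `L²`.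
  Proof: if `H` were a.e. even, the continuous primitive `F(t) = ∫_{-a}^t H` would be odd
  (`∫_{-a}^{a} H = 0`); it agrees a.e. with the everywhere even `c₂u₁ − c₁u₂`, so `F = 0` a.e.,
  hence everywhere, hence `c₂u₁ = c₁u₂` a.e.; pairing with `conj u₁` (`‖u₁‖₂ = 1`,
  `u₂ ⊥ u₁`) gives `c₂ = 0`, and then `‖c₁‖² = ∫|c₁u₂|² = 0`.

No definitions, no named facts.
-/

noncomputable section

open Set MeasureTheory Filter Complex
open scoped Real Topology ComplexConjugate

namespace Summit.RiemannHypothesis.RiemannHypothesis.Theorems.GroundStateSimpleEven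

open Literature.NumberTheory.LFunctions

-- `linter.dupNamespace` off: the mandated namespace `Summit.RiemannHypothesis.RiemannHypothesis.…`
-- (single-problem summit) repeats a component.
set_option linter.dupNamespace false

/-! ## Odd parts in `L²` -/

section OddPart

variable {g H : ℝ → ℂ} {f : ℕ → ℝ → ℂ}

/-- Square integrability is invariant under the reflection `t ↦ -t`. [folklore] -/
theorem memLp_two_comp_neg' (hH : MemLp H 2) : MemLp (fun t ↦ H (-t)) 2 :=
  hH.comp_measurePreserving (Measure.measurePreserving_neg (volume : Measure ℝ))

/-- The odd part of a square-integrable function is square integrable. [folklore] -/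
theorem memLp_two_oddPart (hH : MemLp H 2) : MemLp (fun t ↦ (H t - H (-t)) / 2) 2 := by
  have h := (hH.sub (memLp_two_comp_neg' hH)).const_mul (1 / 2 : ℂ)
  convert h using 1
  funext t
  simp only [Pi.sub_apply]
  ring

/-- **Taking odd parts is an `L²`-contraction**:
`∫ |½(g − g(-·)) − ½(H − H(-·))|² ≤ ∫ |g − H|²` (convexity of `|·|²` and reflection invariance
of Lebesgue measure). [folklore] -/
theorem integral_norm_sq_oddPart_sub_le (hg : MemLp g 2) (hH : MemLp H 2) :
    ∫ t, ‖(g t - g (-t)) / 2 - (H t - H (-t)) / 2‖ ^ 2 ≤ ∫ t, ‖g t - H t‖ ^ 2 := by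
  set D : ℝ → ℂ := fun t ↦ g t - H t with hDdef
  have hD : MemLp D 2 := hg.sub hH
  have hDi : Integrable fun t ↦ ‖D t‖ ^ 2 := (memLp_two_iff_integrable_sq_norm hD.1).1 hD
  have hDin : Integrable fun t ↦ ‖D (-t)‖ ^ 2 := hDi.comp_neg
  have hpt : ∀ t, ‖(g t - g (-t)) / 2 - (H t - H (-t)) / 2‖ ^ 2 ≤
      (‖D t‖ ^ 2 + ‖D (-t)‖ ^ 2) / 2 := by
    intro t
    have e : (g t - g (-t)) / 2 - (H t - H (-t)) / 2 = (D t - D (-t)) / 2 := by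
      simp only [hDdef]
      ring
    rw [e]
    have h1 : ‖(D t - D (-t)) / 2‖ ≤ (‖D t‖ + ‖D (-t)‖) / 2 := by
      rw [norm_div, Complex.norm_two]
      exact div_le_div_of_nonneg_right (norm_sub_le _ _) zero_le_two
    have h2 : 0 ≤ ‖(D t - D (-t)) / 2‖ := norm_nonneg _
    nlinarith [sq_nonneg (‖D t‖ - ‖D (-t)‖), norm_nonneg (D t), norm_nonneg (D (-t)),
      mul_self_le_mul_self h2 h1]
  calc ∫ t, ‖(g t - g (-t)) / 2 - (H t - H (-t)) / 2‖ ^ 2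
      ≤ ∫ t, (‖D t‖ ^ 2 + ‖D (-t)‖ ^ 2) / 2 :=
        integral_mono_of_nonneg (ae_of_all _ fun t ↦ by positivity) ((hDi.add hDin).div_const 2)
          (ae_of_all _ hpt)
    _ = ((∫ t, ‖D t‖ ^ 2) + ∫ t, ‖D (-t)‖ ^ 2) / 2 := by rw [integral_div, integral_add hDi hDin]
    _ = ∫ t, ‖D t‖ ^ 2 := by
        rw [integral_neg_eq_self (fun t ↦ ‖D t‖ ^ 2) volume]
        ring

/-- Odd parts converge in `L²` along an `L²`-convergent sequence. [folklore] -/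
theorem tendsto_integral_norm_sq_oddPart (hH : MemLp H 2) (hf : ∀ n, MemLp (f n) 2)
    (hlim : Tendsto (fun n ↦ ∫ t, ‖f n t - H t‖ ^ 2) atTop (𝓝 0)) :
    Tendsto (fun n ↦ ∫ t, ‖(f n t - f n (-t)) / 2 - (H t - H (-t)) / 2‖ ^ 2) atTop (𝓝 0) :=
  squeeze_zero (fun n ↦ integral_nonneg fun _ ↦ by positivity)
    (fun n ↦ integral_norm_sq_oddPart_sub_le (hf n) hH) hlim

end OddPart

/-! ## The odd part of the EDGE derivative `H` is non-zero -/

section Nonzero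

variable {a : ℝ} {u₁ u₂ H : ℝ → ℂ} {c₁ c₂ : ℂ}

/-- **The odd part of `H` is not zero in `L²`.** Let `u₁, u₂` be even ground states at window
`a` with `∫ conj u₁ · u₂ = 0`, `(c₁, c₂) ≠ (0, 0)`, and let `H ∈ L²` vanish a.e. off `[-a, a]`,
have `∫ H = 0`, and satisfy `c₂u₁ − c₁u₂ = ∫_{-a}^t H` for a.e. `t`.  Then
`0 < ∫ |½(H − H(-·))|²`.  (If `H` were a.e. even, the continuous odd primitive `F = ∫_{-a}^· H`
would agree a.e. with the even function `c₂u₁ − c₁u₂`, forcing `F ≡ 0`, `c₂u₁ = c₁u₂` a.e., and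
`c₁ = c₂ = 0` by `‖u₁‖₂ = 1`, `u₂ ⊥ u₁`, `‖u₂‖₂ = 1`.) [folklore] -/
theorem integral_norm_sq_oddPart_pos (hu₁ : IsWeilGroundState a u₁) (hu₂ : IsWeilGroundState a u₂)
    (hev₁ : ∀ t, u₁ (-t) = u₁ t) (hev₂ : ∀ t, u₂ (-t) = u₂ t)
    (horth : ∫ t, starRingEnd ℂ (u₁ t) * u₂ t = 0) (hc : c₁ ≠ 0 ∨ c₂ ≠ 0) (hH : MemLp H 2)
    (hHz : ∀ᵐ t : ℝ, t ∉ Icc (-a) a → H t = 0) (hH0 : ∫ t, H t = 0)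
    (hprim : ∀ᵐ t : ℝ, c₂ * u₁ t - c₁ * u₂ t = ∫ s in (-a)..t, H s) :
    0 < ∫ t, ‖(H t - H (-t)) / 2‖ ^ 2 := by
  have ha : 0 < a := hu₁.pos
  have hHi : Integrable H := by
    have h1 : IntegrableOn H (Icc (-a) a) := (hH.restrict (Icc (-a) a)).integrable one_le_two
    exact h1.integrable_of_ae_notMem_eq_zero hHz
  set F : ℝ → ℂ := fun t ↦ ∫ s in (-a)..t, H s with hF
  set G : ℝ → ℂ := fun t ↦ c₂ * u₁ t - c₁ * u₂ t with hG
  have hGev : ∀ t, G (-t) = G t := fun t ↦ by simp [hG, hev₁ t, hev₂ t]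
  have hFc : Continuous F :=
    intervalIntegral.continuous_primitive (fun _ _ ↦ hHi.intervalIntegrable) (-a)
  have hGF : G =ᵐ[volume] F := hprim
  -- `∫_{-a}^{a} H = ∫ H = 0`
  have hIaa : ∫ s in (-a)..a, H s = 0 := by
    rw [intervalIntegral.integral_of_le (by linarith), ← hH0]
    apply setIntegral_eq_integral_of_ae_compl_eq_zero
    have hne : ∀ᵐ t : ℝ, t ≠ -a := by
      rw [ae_iff]
      simp
    filter_upwards [hHz, hne] with t ht hta hts
    exact ht fun htI ↦ hts ⟨lt_of_le_of_ne htI.1 (Ne.symm hta), htI.2⟩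
  by_contra hnot
  have hz : ∫ t, ‖(H t - H (-t)) / 2‖ ^ 2 = 0 :=
    le_antisymm (not_lt.1 hnot) (integral_nonneg fun _ ↦ by positivity)
  -- `H` is a.e. even
  have hHo : MemLp (fun t ↦ (H t - H (-t)) / 2) 2 := memLp_two_oddPart hH
  have hint : Integrable fun t ↦ ‖(H t - H (-t)) / 2‖ ^ 2 :=
    (memLp_two_iff_integrable_sq_norm hHo.1).1 hHo
  have hae0 := (integral_eq_zero_iff_of_nonneg (fun t ↦ by positivity) hint).1 hz
  have heven : ∀ᵐ t : ℝ, H (-t) = H t := hae0.mono fun t ht ↦ by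
    have h1 : ‖(H t - H (-t)) / 2‖ ^ 2 = 0 := ht
    have h2 : (H t - H (-t)) / 2 = 0 := by simpa using h1
    linear_combination (-2 : ℂ) * h2
  -- the primitive is odd
  have hFodd : ∀ t, F (-t) = -F t := by
    intro t
    have h1 : F (-t) = ∫ s in t..a, H (-s) := (intervalIntegral.integral_comp_neg H).symm
    have h2 : ∫ s in t..a, H (-s) = ∫ s in t..a, H s :=
      intervalIntegral.integral_congr_ae (heven.mono fun s hs _ ↦ hs)
    have h3 : (∫ s in (-a)..t, H s) + ∫ s in t..a, H s = ∫ s in (-a)..a, H s :=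
      intervalIntegral.integral_add_adjacent_intervals hHi.intervalIntegrable hHi.intervalIntegrable
    rw [h1, h2]
    linear_combination h3 + hIaa
  -- `F = G` a.e. with `G` even and `F` odd: `F = 0` a.e., hence everywhere
  have hGFneg : (fun t ↦ G (-t)) =ᵐ[volume] fun t ↦ F (-t) :=
    (Measure.measurePreserving_neg (volume : Measure ℝ)).quasiMeasurePreserving.ae_eq_comp hGF
  have hF0ae : F =ᵐ[volume] 0 := by
    filter_upwards [hGF, hGFneg] with t h1 h2
    have h3 : F t = -F t :=
      calc F t = G t := h1.symm
        _ = G (-t) := (hGev t).symm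
        _ = F (-t) := h2
        _ = -F t := hFodd t
    show F t = 0
    linear_combination h3 / 2
  have hF0 : F = 0 := (Continuous.ae_eq_iff_eq volume hFc continuous_zero).1 hF0ae
  have hG0 : G =ᵐ[volume] 0 := hF0 ▸ hGF
  -- `c₂ = 0`: pair `G = 0` with `conj u₁`
  have hi₁ : Integrable fun t ↦ u₁ t * conj (u₁ t) :=
    hu₁.memLp.integrable_mul (ConnesVanSuijlekom.memLp_conj hu₁.memLp)
  have hi₂ : Integrable fun t ↦ u₂ t * conj (u₁ t) :=
    hu₂.memLp.integrable_mul (ConnesVanSuijlekom.memLp_conj hu₁.memLp)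
  have hc₂ : c₂ = 0 := by
    have h0 : ∫ t, G t * conj (u₁ t) = 0 := by
      rw [integral_congr_ae (hG0.mono fun t ht ↦ show G t * conj (u₁ t) = (0 : ℝ → ℂ) t by
        simp [ht])]
      simp
    have h1 : ∫ t, G t * conj (u₁ t) =
        c₂ * (∫ t, u₁ t * conj (u₁ t)) - c₁ * ∫ t, u₂ t * conj (u₁ t) := by
      rw [← integral_const_mul, ← integral_const_mul,
        ← integral_sub (hi₁.const_mul _) (hi₂.const_mul _)]
      congr 1 with t
      simp only [hG]
      ring
    have h2 : ∫ t, u₁ t * conj (u₁ t) = 1 := by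
      rw [ConnesVanSuijlekom.integral_mul_conj_self, hu₁.integral_norm_sq]
      simp
    have h3 : ∫ t, u₂ t * conj (u₁ t) = 0 := by
      simp_rw [mul_comm (u₂ _)]
      exact horth
    rw [h1, h2, h3] at h0
    simpa using h0
  -- `c₁ = 0`: `‖c₁‖² = ∫ |G|² = 0`
  have hc₁ : c₁ = 0 := by
    have h0 : ∫ t, ‖G t‖ ^ 2 = 0 := by
      rw [integral_congr_ae (hG0.mono fun t ht ↦ show ‖G t‖ ^ 2 = (0 : ℝ → ℝ) t by simp [ht])]
      simp
    have h1 : ∫ t, ‖G t‖ ^ 2 = ‖c₁‖ ^ 2 := by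
      simp only [hG, hc₂, zero_mul, zero_sub, norm_neg, norm_mul, mul_pow]
      rw [integral_const_mul, hu₂.integral_norm_sq, mul_one]
    rw [h1] at h0
    exact norm_eq_zero.1 (pow_eq_zero_iff two_ne_zero |>.1 h0)
  exact hc.elim (fun h ↦ h hc₁) (fun h ↦ h hc₂)

end Nonzero

end Summit.RiemannHypothesis.RiemannHypothesis.Theorems.GroundStateSimpleEven

namespace Summit.RiemannHypothesis.RiemannHypothesis.Theorems

open Literature.NumberTheory.LFunctions

set_option linter.dupNamespace false in
/-- **Registered sub-goal of stub INTERTWINE (helper 3): the odd part of the EDGE derivative is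
non-zero.** With the data of `stub_evenPair_edgeCancellation` (even ground states `u₁ ⊥ u₂`,
`(c₁, c₂) ≠ 0`, `H ∈ L²` on the window, `∫ H = 0`, `c₂u₁ − c₁u₂ = ∫_{-a}^t H` a.e.):
`0 < ∫ |½(H − H(-·))|²` (`GroundStateSimpleEven.integral_norm_sq_oddPart_pos`). [folklore] -/
theorem stub_intertwine_oddPartNonzero :
    ∀ a : ℝ, 0 < a → ∀ u₁ u₂ : ℝ → ℂ, IsWeilGroundState a u₁ → IsWeilGroundState a u₂ →
      (∀ t, u₁ (-t) = u₁ t) → (∀ t, u₂ (-t) = u₂ t) → ∫ t, starRingEnd ℂ (u₁ t) * u₂ t = 0 →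
      ∀ c₁ c₂ : ℂ, (c₁ ≠ 0 ∨ c₂ ≠ 0) → ∀ H : ℝ → ℂ, MemLp H 2 →
        (∀ᵐ t : ℝ, t ∉ Icc (-a) a → H t = 0) → ∫ t, H t = 0 →
        (∀ᵐ t : ℝ, c₂ * u₁ t - c₁ * u₂ t = ∫ s in (-a)..t, H s) →
        0 < ∫ t, ‖(H t - H (-t)) / 2‖ ^ 2 :=
  fun _ _ _ _ hu₁ hu₂ hev₁ hev₂ horth _ _ hc _ hH hHz hH0 hprim =>
    GroundStateSimpleEven.integral_norm_sq_oddPart_pos hu₁ hu₂ hev₁ hev₂ horth hc hH hHz hH0 hprim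

end Summit.RiemannHypothesis.RiemannHypothesis.Theorems

end
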